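import Summits.AtomisticToContinuum.BoseEinsteinCondensation.Theses.BECFeynmanVortexArea
import Summits.AtomisticToContinuum.BoseEinsteinCondensation.Theses.BECNoCheapMomentum
import Literature.Barriers.AtomisticToContinuum.KineticGapLengthScalesFreeGas
import Literature.MathematicalPhysics.QuantumManyBody.BoseGasProductState
import Literature.MathematicalPhysics.QuantumManyBody.MeanSelfDensity

/-!
# Route BECFeynmanVortexArea — `FreeGasCondensation` (support item stmt-AtomisticToContinuum-11847)

The a.e.-free gas condenses on the torus: if `v` is measurable with `∫_{ℝ³} v(|x|) dx = 0`
(`v(|·|) = 0` a.e.), then every pair term `v(|xᵢ - xⱼ - Ln|)` vanishes for a.e. configuration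
(split off particle `i` by Tonelli and use the translation invariance of Lebesgue measure), so the
periodised interaction `∑_{i<j} v^per(xᵢ - xⱼ)` — a finite sum of countable lattice sums of such
terms — vanishes a.e. on `(ℝ³)^N`. Hence `periodicEnergy v Ψ = periodicEnergy 0 Ψ` for every
periodic trial state and `E₀^per(v; N, L) = E₀^per(0; N, L)`, and the statement is literally the
tree's free-gas instance `periodicBEC_antecedent_free` (`KineticGapLengthScalesFreeGas.lean`:
`c = 1/2`, slack of one kinetic gap per particle, from LSSY Lemma 4.1 / (5.15)–(5.17)).
-/

noncomputable section

namespace Summit.AtomisticToContinuum.BoseEinsteinCondensation.Theorems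

open MeasureTheory Filter Literature.MathematicalPhysics.QuantumManyBody.BoseGas
open scoped ENNReal

/-- **A pair term of an a.e.-vanishing potential vanishes for a.e. configuration**: if
`∫ v(|x|) dx = 0` then `v(|xᵢ - xⱼ - c|) = 0` for a.e. `X ∈ (ℝ³)^N` (`i ≠ j`). Proof: relabel
`i ↦ 0`, integrate out particle `0` first (Tonelli) and use translation invariance, so the whole
configuration integral vanishes. [folklore] -/
theorem ae_pairPotential_eq_zero {N : ℕ} {v : ℝ → ℝ≥0∞} (hv : Measurable v)
    (h0 : ∫⁻ x : Space, v ‖x‖ = 0) {i j : Fin N} (hij : i ≠ j) (c : Space) :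
    ∀ᵐ X : Config N, v ‖X i - X j - c‖ = 0 := by
  obtain ⟨n, rfl⟩ : ∃ n, N = n + 1 := ⟨N - 1, (Nat.sub_add_cancel i.pos).symm⟩
  set σ : Equiv.Perm (Fin (n + 1)) := Equiv.swap 0 i with hσ
  set j' : Fin (n + 1) := σ j with hj'
  have hj'0 : j' ≠ 0 := by
    intro h
    apply hij
    have : σ.symm (σ j) = σ.symm 0 := by rw [← hj', h]
    rw [Equiv.symm_apply_apply] at this
    rw [this, hσ, Equiv.symm_swap, Equiv.swap_apply_left]
  obtain ⟨k, hk⟩ : ∃ k : Fin n, k.succ = j' := ⟨j'.pred hj'0, Fin.succ_pred _ _⟩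
  -- the relabelled pair term, with particle `0` in place of `i`
  set G : Config (n + 1) → ℝ≥0∞ := fun X => v ‖X 0 - X j' - c‖ with hG
  have hGm : Measurable G :=
    hv.comp ((((continuous_apply 0).sub (continuous_apply j')).sub continuous_const).norm.measurable)
  have hFG : (fun X : Config (n + 1) => v ‖X i - X j - c‖) = fun X => G (X ∘ σ) := by
    funext X
    simp only [hG, Function.comp_apply, hj']
    rw [hσ, Equiv.swap_apply_left, Equiv.swap_apply_self]
  have hFm : Measurable fun X : Config (n + 1) => v ‖X i - X j - c‖ := by
    rw [hFG]
    exact hGm.comp (measurable_pi_lambda _ fun a => measurable_pi_apply _)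
  -- the configuration integral vanishes
  have hint : ∫⁻ X : Config (n + 1), v ‖X i - X j - c‖ = 0 := by
    rw [hFG, lintegral_comp_perm σ G, lintegral_eq_lintegral_lintegral_vecCons hGm]
    refine (lintegral_congr fun Y => ?_).trans lintegral_zero
    have hslice : ∀ x : Space, G (Matrix.vecCons x Y) = v ‖x - (Y k + c)‖ := by
      intro x
      simp only [hG, ← hk, Matrix.cons_val_zero, Matrix.cons_val_succ, sub_sub]
    simp only [hslice]
    rw [lintegral_sub_right_eq_self (fun y : Space => v ‖y‖) (Y k + c)]
    exact h0
  exact (lintegral_eq_zero_iff hFm).1 hint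

/-- **The periodised interaction of an a.e.-vanishing potential vanishes for a.e. configuration**
(finite sum over pairs of countable lattice sums of a.e.-vanishing pair terms). [folklore] -/
theorem ae_periodicInteraction_eq_zero {N : ℕ} {v : ℝ → ℝ≥0∞} (hv : Measurable v)
    (h0 : ∫⁻ x : Space, v ‖x‖ = 0) (L : ℝ) :
    ∀ᵐ X : Config N, periodicInteraction v L X = 0 := by
  have h : ∀ᵐ X : Config N, ∀ i j : Fin N, i ≠ j → ∀ m : Fin 3 → ℤ,
      v ‖X i - X j - latticeVec L m‖ = 0 := by
    refine ae_all_iff.2 fun i => ae_all_iff.2 fun j => ?_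
    by_cases hij : i = j
    · exact Eventually.of_forall fun X h => absurd hij h
    · exact (ae_all_iff.2 fun m => ae_pairPotential_eq_zero hv h0 hij (latticeVec L m)).mono
        fun X hX _ => hX
  refine h.mono fun X hX => ?_
  unfold periodicInteraction periodizedPotential
  refine Finset.sum_eq_zero fun i _ => Finset.sum_eq_zero fun j hj => ?_
  exact ENNReal.tsum_eq_zero.2 fun m => hX i j (Finset.mem_filter.1 hj).2.ne m

/-- **The a.e.-free gas has the free energy functional**: `periodicEnergy v Ψ = periodicEnergy 0 Ψ`
for every periodic trial state when `∫ v(|x|) dx = 0`. [folklore] -/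
theorem periodicEnergy_eq_zero_pot {N : ℕ} {L : ℝ} {v : ℝ → ℝ≥0∞} (hv : Measurable v)
    (h0 : ∫⁻ x : Space, v ‖x‖ = 0) (Ψ : PeriodicTrialState N L) :
    periodicEnergy v Ψ = periodicEnergy 0 Ψ := by
  unfold periodicEnergy
  refine lintegral_congr_ae ?_
  refine (ae_restrict_of_ae (ae_periodicInteraction_eq_zero hv h0 L)).mono fun X hX => ?_
  have h0' : periodicInteraction 0 L X = 0 := by
    simp [periodicInteraction, periodizedPotential]
  show kineticDensity Ψ.ψ X + periodicInteraction v L X * _ =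
    kineticDensity Ψ.ψ X + periodicInteraction 0 L X * _
  rw [hX, h0']

/-- … and hence the free ground-state energy: `E₀^per(v; N, L) = E₀^per(0; N, L)`. [folklore] -/
theorem periodicGroundStateEnergy_eq_zero_pot {v : ℝ → ℝ≥0∞} (hv : Measurable v)
    (h0 : ∫⁻ x : Space, v ‖x‖ = 0) (N : ℕ) (L : ℝ) :
    periodicGroundStateEnergy v N L = periodicGroundStateEnergy 0 N L := by
  unfold periodicGroundStateEnergy
  exact iInf_congr fun Ψ => periodicEnergy_eq_zero_pot hv h0 Ψ

/-- Settles `stmt-AtomisticToContinuum-11847` (exact signature): the a.e.-free gas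
(`∫ v(|x|) dx = 0`) condenses in the constant mode of the torus — near-minimisers of
`periodicEnergy v` are near-minimisers of the free functional (the interaction vanishes a.e.), to
which the tree's free-gas condensation `periodicBEC_antecedent_free` (LSSY Lemma 4.1 /
(5.15)–(5.17) at `v = 0`: `c = 1/2`, slack one kinetic gap per particle) applies verbatim.
[cite: LSSY2005, Ch. 5 (5.15)–(5.17)] -/
theorem freeGasCondensation_proof :
    Summit.AtomisticToContinuum.BoseEinsteinCondensation.Theses.BECFeynmanVortexArea.FreeGasCondensation := by
  intro v hv h0
  obtain ⟨ρ₀, hρ₀, h⟩ :=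
    Literature.Barriers.AtomisticToContinuum.BoseGas.periodicBEC_antecedent_free
  refine ⟨ρ₀, hρ₀, fun ρ hρ hρ₀' => ?_⟩
  obtain ⟨c, hc, hN⟩ := h ρ hρ hρ₀'
  refine ⟨c, hc, ?_⟩
  filter_upwards [hN] with N hN'
  obtain ⟨δ, hδ, hΨ⟩ := hN'
  refine ⟨δ, hδ, fun Ψ hle => hΨ Ψ ?_⟩
  rwa [periodicEnergy_eq_zero_pot hv.1 h0, periodicGroundStateEnergy_eq_zero_pot hv.1 h0] at hle

/-- The twin item of route `BECNoCheapMomentum` (the same statement, verbatim; shared item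
stmt-AtomisticToContinuum-11847). [cite: LSSY2005, Ch. 5 (5.15)–(5.17)] -/
theorem noCheapMomentum_freeGasCondensation_proof :
    Summit.AtomisticToContinuum.BoseEinsteinCondensation.Theses.BECNoCheapMomentum.FreeGasCondensation :=
  freeGasCondensation_proof

end Summit.AtomisticToContinuum.BoseEinsteinCondensation.Theorems

end
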